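import Mathlib
import HarnessLib
import HarnessLib.Audit
import Summits.Langlands.Statement
import Summits.Langlands.Langlands.Theses.CoreAdequacySplit
import Summits.Langlands.Langlands.Theorems.CoreAdequacySplit
import Summits.Langlands.Langlands.Theorems.BrightMateBypass
import Literature.NumberTheory.GaloisRepresentations.ResidualGaloisRep
import Literature.NumberTheory.GaloisRepresentations.AdequateSubgroup
import Summits.Langlands.Langlands.Theses.LieDefectSplit

/-! # birth skeleton (BC3) of LIE = `LieDefectSplit.LieObstructedLifting` + the BC5 PLAN-ONLY rung.
Pre-birth form: LIE is declared locally VERBATIM (after birth: `import Summits.Langlands.Langlands.Theses.LieDefectSplit`, delete the local def, and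
conclude `Summit.Langlands.Langlands.Theses.LieDefectSplit.LieObstructedLifting`).  Split by RANK and base field: rank ≤ 2 over a totally real K
(RUNG — the Kisin 2009 / Khare–Thorne 2017 sector: by BLGG13 Prop 6.2.1 and the census GAP table I-L5g11 the only rank-2 LIE rows are ℓ = 5 with projective image PSL₂(𝔽₅) ≅ A₅ over K(ζ₅) — the PGL₂(𝔽₅)-image groups are adequate, h¹(GL₂(𝔽₅), 𝔤𝔩₂) = 0;
n = 1 is degenerate, ad⁰ = 0), rank ≤ 2 over a non-totally-real K (dark: no patching — TaylorWilesNumericalCoincidence), rank ≥ 3 (Khare–Thorne's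
announced extension «certainly yes»; groups listed by Guralnick–Herzig–Tiep 2015 Thm 1.3 for ℓ > d).  Every stub carries LIE's hypotheses verbatim
(incl. the dial SQAL, the two R1 carves of RSL and — v2 — the new carve ¬D↓ `¬ SolvableDescentShadow ρ` of critic row 189 (F2), inlined); the cells are
structured over the landed twin `Theorems.CoreAdequacy` BY NAME.  sorries ONLY inside `stub_*`. -/

set_option linter.dupNamespace false

namespace Summit.Langlands.Langlands.Cruxes.LieObstructedLifting.Birth

open Filter

open Summit.Langlands.Langlands.Theses.LieDefectSplit (LieObstructedLifting)

/-- BC5 PLAN-ONLY RUNG (tribunal T3, `T3-plan-only`) and first stub: LIE on rank n ≤ 2 over a TOTALLY REAL K.  n = 1 is degenerate (ad⁰ = 0, so a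
quasi-adequate layer is adequate and the hypotheses SQAL ∧ ¬SADQ clash); n = 2 forces ℓ = 5 and projective image A₅ = PSL₂(𝔽₅) over K(ζ₅)
(BLGG13 App. A Prop 6.2.1 + Point 2 [corpus:paper:arxiv-1106.5586 p21–24] and the census GAP table I-L5g11: clauses (i), (ii), (iv) hold, only
H¹(H, ad⁰) = 0 fails, h¹ = 1; the PGL₂(𝔽₅)-image groups are ADEQUATE; (2,3) is EMPTY; (2,2) is the slab).  Over K: projective image A₅, or S₅ with
sign field inside K(ζ₅).  IN PRINT for parallel weight 2 (HT_τ = {0,1}) and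
residually modular ρ̄ (which LiftTail supplies as its «linked to a weakly automorphic ρ'» hypothesis): Kisin 2009, Ann. of Math. 170, main theorem
(p = 5 allowed unless ρ̄ is exceptional: proj. image PGL₂(𝔽₅) over F with ζ₅ ∈ F(ad ρ̄), forcing [F(ζ₅):F] = 2 — Khare–Thorne p3 «the new case as
compared to [Kisin]»; for projective image A₅ over F the Chebotarev obstruction (H¹(A₅, ad⁰) ⊗ ε̄)^{Gal(F(ζ₅)/F)} vanishes because ζ₅ ∉ F) + Khare–Thorne 2017 Thm 1.1 [corpus:paper:arxiv-1503.03796 p3] (the exceptional case: Lie classes killed at places v with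
q_v ≡ 1 (5), q_v ≢ 1 (25), ρ̄(Frob_v) of order divisible by 5; automorphy and level lowering mod p^N [ibid. p4]).  NOT in print as typed: other
Hodge–Tate weights (weight changing à la BLGG needs adequacy — exactly the Lie-class lever again) — hence PLAN-ONLY.  Outside S's known regime:
Langlands for GL₂ over totally real fields is open (no Serre, no general weight), and the rung is a LIFTING statement whose only obstruction is the
Lie class — it exercises the route's lever, not the residual.  Technique: Khare–Thorne §§5–8 (modified local condition at p-divisible-order places,
R = 𝕋 mod p^N, level lowering mod p^N) on top of Kisin's patching; for general weight, Hida/Coleman families or BLGG weight cycling with the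
Khare–Thorne device replacing adequacy. -/
theorem stub_rung_rankLe2_totallyReal : ∀ (K : Type) [Field K] [NumberField K] (n : ℕ) (hcpt : Literature.NumberTheory.Automorphic.isCompact_glFiniteIntegralLevel n K), 0 < n → Summit.Langlands.Langlands.Theorems.CoreAdequacy.LiftBelow n → ∀ (ℓ : ℕ) [Fact ℓ.Prime] (ι : PadicAlgCl ℓ ≃+* ℂ) (ρ : Literature.NumberTheory.GaloisRepresentations.FramedGaloisRep K (PadicAlgCl ℓ) n), ℓ < 2 * (n + 1) → NumberField.IsTotallyReal K → n ≤ 2 → Summit.Langlands.Langlands.Theorems.CoreAdequacy.CycIrr ρ → ¬ Summit.Langlands.Langlands.Theorems.CoreAdequacy.AdequateCyclotomicImage ρ → ¬ Summit.Langlands.Langlands.Theorems.CoreAdequacy.SolvablyAdequateImage ρ → ¬ (∃ (K₀ : Type) (_ : Field K₀) (_ : NumberField K₀) (_ : Algebra K₀ K), IsGalois K₀ K ∧ IsSolvable (K ≃ₐ[K₀] K) ∧ ∃ (ρ₀ : Literature.NumberTheory.GaloisRepresentations.FramedGaloisRep K₀ (PadicAlgCl ℓ) n) (χ : Literature.NumberTheory.GaloisRepresentations.FramedGaloisRep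 K (PadicAlgCl ℓ) 1), ρ₀.toGaloisRep.IsIrreducible ∧ ((∀ᶠ v : IsDedekindDomain.HeightOneSpectrum (NumberField.RingOfIntegers K₀) in cofinite, ρ₀.IsUnramifiedAt v) ∧ ∀ (v : IsDedekindDomain.HeightOneSpectrum (NumberField.RingOfIntegers K₀)) (hv : ((ℓ : ℕ) : NumberField.RingOfIntegers K₀) ∈ v.asIdeal), (Literature.NumberTheory.PAdicHodge.fontainePstAdicCompletion v ℓ hv).IsDeRhamFramed (ρ₀.toLocal v)) ∧ ((∀ᶠ v : IsDedekindDomain.HeightOneSpectrum (NumberField.RingOfIntegers K) in cofinite, χ.IsUnramifiedAt v) ∧ ∀ (v : IsDedekindDomain.HeightOneSpectrum (NumberField.RingOfIntegers K)) (hv : ((ℓ : ℕ) : NumberField.RingOfIntegers K) ∈ v.asIdeal), (Literature.NumberTheory.PAdicHodge.fontainePstAdicCompletion v ℓ hv).IsDeRhamFramed (χ.toLocal v)) ∧ Summit.Langlands.Langlands.Theorems.CoreAdequacy.CycIrr ρ₀ ∧ (Summit.Langlands.Langlands.Theorems.CoreAdequacy.AdequateCyclotomicImage ρ₀ ∨ Summit.Langlands.Langlands.Theorems.CoreAdequacy.SolvablyAdequateImage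 ρ₀) ∧ ∀ g : Field.absoluteGaloisGroup K, Literature.NumberTheory.GaloisRepresentations.FramedRep.trace ρ g = Literature.NumberTheory.GaloisRepresentations.FramedRep.trace χ g * Literature.NumberTheory.GaloisRepresentations.FramedRep.trace (ρ₀.restrictField K) g) → (∃ τ : Field.absoluteGaloisGroup (CyclotomicField ℓ K) →* Matrix.GeneralLinearGroup (Fin n) (Literature.NumberTheory.GaloisRepresentations.padicAlgClResidueField ℓ), (ρ.restrictField (CyclotomicField ℓ K)).IsReductionOf (RingHom.id (Literature.NumberTheory.GaloisRepresentations.padicAlgClResidueField ℓ)) τ ∧ Literature.NumberTheory.GaloisRepresentations.IsAbsIrreducible τ ∧ ∃ J : Subgroup (Matrix.GeneralLinearGroup (Fin n) (Literature.NumberTheory.GaloisRepresentations.padicAlgClResidueField ℓ)), (∀ Q : Subgroup (Matrix.GeneralLinearGroup (Fin n) (Literature.NumberTheory.GaloisRepresentations.padicAlgClResidueField ℓ)), Q ≤ τ.range → ⁅Q, Q⁆ = Q → Q ≤ J) ∧ J ≤ τ.range ∧ Literature.NumberTheory.GaloisRepresentations.IsAbsIrreducible J.subtype ∧ (∀ f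 : Additive J →+ Literature.NumberTheory.GaloisRepresentations.padicAlgClResidueField ℓ, f = 0) ∧ (Literature.NumberTheory.GaloisRepresentations.Subgroup.adZeroRep J).invariants = ⊥ ∧ ∀ W : Subrepresentation (Literature.NumberTheory.GaloisRepresentations.Subgroup.adZeroRep J), IsAtom W → ∃ h : J, (orderOf h.1).Coprime (ringChar (Literature.NumberTheory.GaloisRepresentations.padicAlgClResidueField ℓ)) ∧ ∃ α : Literature.NumberTheory.GaloisRepresentations.padicAlgClResidueField ℓ, ∃ w ∈ W, (Literature.NumberTheory.GaloisRepresentations.eigenprojectionMatrix (h.1 : Matrix (Fin n) (Fin n) (Literature.NumberTheory.GaloisRepresentations.padicAlgClResidueField ℓ)) α * w.1).trace ≠ 0) → ¬ Summit.Langlands.Langlands.Theorems.BrightMate.SolvablyReducible ρ → ¬ Summit.Langlands.Langlands.Theorems.BrightMate.SolvablyMated ι ρ → Summit.Langlands.Langlands.Theorems.CoreAdequacy.LiftTail K n hcpt ℓ ι ρ := by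
  sorry

/-- Rank ≤ 2 over a NON-totally-real K: the same (2,5) A₅/S₅ world without any patching theorem (no numerical coincidence off totally real / CM
fields: Literature.Barriers.Langlands.TaylorWilesNumericalCoincidence; Calegari–Geraghty needs vanishing conjectures).  Dark, like AIL off CM/TR. -/
theorem stub_lie_rankLe2_nonTotallyReal : ∀ (K : Type) [Field K] [NumberField K] (n : ℕ) (hcpt : Literature.NumberTheory.Automorphic.isCompact_glFiniteIntegralLevel n K), 0 < n → Summit.Langlands.Langlands.Theorems.CoreAdequacy.LiftBelow n → ∀ (ℓ : ℕ) [Fact ℓ.Prime] (ι : PadicAlgCl ℓ ≃+* ℂ) (ρ : Literature.NumberTheory.GaloisRepresentations.FramedGaloisRep K (PadicAlgCl ℓ) n), ℓ < 2 * (n + 1) → ¬ NumberField.IsTotallyReal K → n ≤ 2 → Summit.Langlands.Langlands.Theorems.CoreAdequacy.CycIrr ρ → ¬ Summit.Langlands.Langlands.Theorems.CoreAdequacy.AdequateCyclotomicImage ρ → ¬ Summit.Langlands.Langlands.Theorems.CoreAdequacy.SolvablyAdequateImage ρ → ¬ (∃ (K₀ : Type) (_ : Field K₀) (_ : NumberField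 K₀) (_ : Algebra K₀ K), IsGalois K₀ K ∧ IsSolvable (K ≃ₐ[K₀] K) ∧ ∃ (ρ₀ : Literature.NumberTheory.GaloisRepresentations.FramedGaloisRep K₀ (PadicAlgCl ℓ) n) (χ : Literature.NumberTheory.GaloisRepresentations.FramedGaloisRep K (PadicAlgCl ℓ) 1), ρ₀.toGaloisRep.IsIrreducible ∧ ((∀ᶠ v : IsDedekindDomain.HeightOneSpectrum (NumberField.RingOfIntegers K₀) in cofinite, ρ₀.IsUnramifiedAt v) ∧ ∀ (v : IsDedekindDomain.HeightOneSpectrum (NumberField.RingOfIntegers K₀)) (hv : ((ℓ : ℕ) : NumberField.RingOfIntegers K₀) ∈ v.asIdeal), (Literature.NumberTheory.PAdicHodge.fontainePstAdicCompletion v ℓ hv).IsDeRhamFramed (ρ₀.toLocal v)) ∧ ((∀ᶠ v : IsDedekindDomain.HeightOneSpectrum (NumberField.RingOfIntegers K) in cofinite, χ.IsUnramifiedAt v) ∧ ∀ (v : IsDedekindDomain.HeightOneSpectrum (NumberField.RingOfIntegers K)) (hv : ((ℓ : ℕ) : NumberField.RingOfIntegers K) ∈ v.asIdeal), (Literature.NumberTheory.PAdicHodge.fontainePstAdicCompletion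 v ℓ hv).IsDeRhamFramed (χ.toLocal v)) ∧ Summit.Langlands.Langlands.Theorems.CoreAdequacy.CycIrr ρ₀ ∧ (Summit.Langlands.Langlands.Theorems.CoreAdequacy.AdequateCyclotomicImage ρ₀ ∨ Summit.Langlands.Langlands.Theorems.CoreAdequacy.SolvablyAdequateImage ρ₀) ∧ ∀ g : Field.absoluteGaloisGroup K, Literature.NumberTheory.GaloisRepresentations.FramedRep.trace ρ g = Literature.NumberTheory.GaloisRepresentations.FramedRep.trace χ g * Literature.NumberTheory.GaloisRepresentations.FramedRep.trace (ρ₀.restrictField K) g) → (∃ τ : Field.absoluteGaloisGroup (CyclotomicField ℓ K) →* Matrix.GeneralLinearGroup (Fin n) (Literature.NumberTheory.GaloisRepresentations.padicAlgClResidueField ℓ), (ρ.restrictField (CyclotomicField ℓ K)).IsReductionOf (RingHom.id (Literature.NumberTheory.GaloisRepresentations.padicAlgClResidueField ℓ)) τ ∧ Literature.NumberTheory.GaloisRepresentations.IsAbsIrreducible τ ∧ ∃ J : Subgroup (Matrix.GeneralLinearGroup (Fin n) (Literature.NumberTheory.GaloisRepresentations.padicAlgClResidueField ℓ)), (∀ Q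 : Subgroup (Matrix.GeneralLinearGroup (Fin n) (Literature.NumberTheory.GaloisRepresentations.padicAlgClResidueField ℓ)), Q ≤ τ.range → ⁅Q, Q⁆ = Q → Q ≤ J) ∧ J ≤ τ.range ∧ Literature.NumberTheory.GaloisRepresentations.IsAbsIrreducible J.subtype ∧ (∀ f : Additive J →+ Literature.NumberTheory.GaloisRepresentations.padicAlgClResidueField ℓ, f = 0) ∧ (Literature.NumberTheory.GaloisRepresentations.Subgroup.adZeroRep J).invariants = ⊥ ∧ ∀ W : Subrepresentation (Literature.NumberTheory.GaloisRepresentations.Subgroup.adZeroRep J), IsAtom W → ∃ h : J, (orderOf h.1).Coprime (ringChar (Literature.NumberTheory.GaloisRepresentations.padicAlgClResidueField ℓ)) ∧ ∃ α : Literature.NumberTheory.GaloisRepresentations.padicAlgClResidueField ℓ, ∃ w ∈ W, (Literature.NumberTheory.GaloisRepresentations.eigenprojectionMatrix (h.1 : Matrix (Fin n) (Fin n) (Literature.NumberTheory.GaloisRepresentations.padicAlgClResidueField ℓ)) α * w.1).trace ≠ 0) → ¬ Summit.Langlands.Langlands.Theorems.BrightMate.SolvablyReducible ρ → ¬ Summit.Langlands.Langlands.Theorems.BrightMate.SolvablyMated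 ι ρ → Summit.Langlands.Langlands.Theorems.CoreAdequacy.LiftTail K n hcpt ℓ ι ρ := by
  sorry

/-- Rank ≥ 3: the Lie-obstructed images listed by Guralnick–Herzig–Tiep 2015 Thm 1.3 for ℓ > d [corpus:paper:arxiv-1311.1786 p3, p38–40] —
(3,5) SL₂(4) ≅ A₅ and 3·A₆, (3,7)/(4,7) PSL₂(7), (4,7) 2·A₇, (4,5) SL₂(9), d = p−1 SL₂(p)×SL₂(p^a), SL₂(3^a) Frobenius-twist tensor products at
ℓ = 3 (e.g. (4,3)) — plus any LOW-range (ℓ ≤ n) image with a quasi-adequate layer.  Engine-in-waiting: Khare–Thorne «certainly yes» for n > 2 and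
their GL₄ ordinary instance [corpus:paper:arxiv-1503.03796 p4]; unwritten in general.  Dark beyond that. -/
theorem stub_lie_rankGe3 : ∀ (K : Type) [Field K] [NumberField K] (n : ℕ) (hcpt : Literature.NumberTheory.Automorphic.isCompact_glFiniteIntegralLevel n K), 0 < n → Summit.Langlands.Langlands.Theorems.CoreAdequacy.LiftBelow n → ∀ (ℓ : ℕ) [Fact ℓ.Prime] (ι : PadicAlgCl ℓ ≃+* ℂ) (ρ : Literature.NumberTheory.GaloisRepresentations.FramedGaloisRep K (PadicAlgCl ℓ) n), ℓ < 2 * (n + 1) → 3 ≤ n → Summit.Langlands.Langlands.Theorems.CoreAdequacy.CycIrr ρ → ¬ Summit.Langlands.Langlands.Theorems.CoreAdequacy.AdequateCyclotomicImage ρ → ¬ Summit.Langlands.Langlands.Theorems.CoreAdequacy.SolvablyAdequateImage ρ → ¬ (∃ (K₀ : Type) (_ : Field K₀) (_ : NumberField K₀) (_ : Algebra K₀ K), IsGalois K₀ K ∧ IsSolvable (K ≃ₐ[K₀] K) ∧ ∃ (ρ₀ : Literature.NumberTheory.GaloisRepresentations.FramedGaloisRep K₀ (PadicAlgCl ℓ)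 n) (χ : Literature.NumberTheory.GaloisRepresentations.FramedGaloisRep K (PadicAlgCl ℓ) 1), ρ₀.toGaloisRep.IsIrreducible ∧ ((∀ᶠ v : IsDedekindDomain.HeightOneSpectrum (NumberField.RingOfIntegers K₀) in cofinite, ρ₀.IsUnramifiedAt v) ∧ ∀ (v : IsDedekindDomain.HeightOneSpectrum (NumberField.RingOfIntegers K₀)) (hv : ((ℓ : ℕ) : NumberField.RingOfIntegers K₀) ∈ v.asIdeal), (Literature.NumberTheory.PAdicHodge.fontainePstAdicCompletion v ℓ hv).IsDeRhamFramed (ρ₀.toLocal v)) ∧ ((∀ᶠ v : IsDedekindDomain.HeightOneSpectrum (NumberField.RingOfIntegers K) in cofinite, χ.IsUnramifiedAt v) ∧ ∀ (v : IsDedekindDomain.HeightOneSpectrum (NumberField.RingOfIntegers K)) (hv : ((ℓ : ℕ) : NumberField.RingOfIntegers K) ∈ v.asIdeal), (Literature.NumberTheory.PAdicHodge.fontainePstAdicCompletion v ℓ hv).IsDeRhamFramed (χ.toLocal v)) ∧ Summit.Langlands.Langlands.Theorems.CoreAdequacy.CycIrr ρ₀ ∧ (Summit.Langlands.Langlands.Theorems.CoreAdequacy.AdequateCyclotomicImage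 ρ₀ ∨ Summit.Langlands.Langlands.Theorems.CoreAdequacy.SolvablyAdequateImage ρ₀) ∧ ∀ g : Field.absoluteGaloisGroup K, Literature.NumberTheory.GaloisRepresentations.FramedRep.trace ρ g = Literature.NumberTheory.GaloisRepresentations.FramedRep.trace χ g * Literature.NumberTheory.GaloisRepresentations.FramedRep.trace (ρ₀.restrictField K) g) → (∃ τ : Field.absoluteGaloisGroup (CyclotomicField ℓ K) →* Matrix.GeneralLinearGroup (Fin n) (Literature.NumberTheory.GaloisRepresentations.padicAlgClResidueField ℓ), (ρ.restrictField (CyclotomicField ℓ K)).IsReductionOf (RingHom.id (Literature.NumberTheory.GaloisRepresentations.padicAlgClResidueField ℓ)) τ ∧ Literature.NumberTheory.GaloisRepresentations.IsAbsIrreducible τ ∧ ∃ J : Subgroup (Matrix.GeneralLinearGroup (Fin n) (Literature.NumberTheory.GaloisRepresentations.padicAlgClResidueField ℓ)), (∀ Q : Subgroup (Matrix.GeneralLinearGroup (Fin n) (Literature.NumberTheory.GaloisRepresentations.padicAlgClResidueField ℓ)), Q ≤ τ.range → ⁅Q, Q⁆ = Q → Q ≤ J) ∧ J ≤ τ.range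 ∧ Literature.NumberTheory.GaloisRepresentations.IsAbsIrreducible J.subtype ∧ (∀ f : Additive J →+ Literature.NumberTheory.GaloisRepresentations.padicAlgClResidueField ℓ, f = 0) ∧ (Literature.NumberTheory.GaloisRepresentations.Subgroup.adZeroRep J).invariants = ⊥ ∧ ∀ W : Subrepresentation (Literature.NumberTheory.GaloisRepresentations.Subgroup.adZeroRep J), IsAtom W → ∃ h : J, (orderOf h.1).Coprime (ringChar (Literature.NumberTheory.GaloisRepresentations.padicAlgClResidueField ℓ)) ∧ ∃ α : Literature.NumberTheory.GaloisRepresentations.padicAlgClResidueField ℓ, ∃ w ∈ W, (Literature.NumberTheory.GaloisRepresentations.eigenprojectionMatrix (h.1 : Matrix (Fin n) (Fin n) (Literature.NumberTheory.GaloisRepresentations.padicAlgClResidueField ℓ)) α * w.1).trace ≠ 0) → ¬ Summit.Langlands.Langlands.Theorems.BrightMate.SolvablyReducible ρ → ¬ Summit.Langlands.Langlands.Theorems.BrightMate.SolvablyMated ι ρ → Summit.Langlands.Langlands.Theorems.CoreAdequacy.LiftTail K n hcpt ℓ ι ρ := by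
  sorry

/-- The split: RUNG → NONTR → RANK≥3 → LIE (case analysis on n ≤ 2 and on `NumberField.IsTotallyReal K`; no other content). -/
theorem LieObstructedLifting_of :
    (∀ (K : Type) [Field K] [NumberField K] (n : ℕ) (hcpt : Literature.NumberTheory.Automorphic.isCompact_glFiniteIntegralLevel n K), 0 < n → Summit.Langlands.Langlands.Theorems.CoreAdequacy.LiftBelow n → ∀ (ℓ : ℕ) [Fact ℓ.Prime] (ι : PadicAlgCl ℓ ≃+* ℂ) (ρ : Literature.NumberTheory.GaloisRepresentations.FramedGaloisRep K (PadicAlgCl ℓ) n), ℓ < 2 * (n + 1) → NumberField.IsTotallyReal K → n ≤ 2 → Summit.Langlands.Langlands.Theorems.CoreAdequacy.CycIrr ρ → ¬ Summit.Langlands.Langlands.Theorems.CoreAdequacy.AdequateCyclotomicImage ρ → ¬ Summit.Langlands.Langlands.Theorems.CoreAdequacy.SolvablyAdequateImage ρ → ¬ (∃ (K₀ : Type) (_ : Field K₀) (_ : NumberField K₀) (_ : Algebra K₀ K), IsGalois K₀ K ∧ IsSolvable (K ≃ₐ[K₀] K) ∧ ∃ (ρ₀ : Literature.NumberTheory.GaloisRepresentations.FramedGaloisRep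 K₀ (PadicAlgCl ℓ) n) (χ : Literature.NumberTheory.GaloisRepresentations.FramedGaloisRep K (PadicAlgCl ℓ) 1), ρ₀.toGaloisRep.IsIrreducible ∧ ((∀ᶠ v : IsDedekindDomain.HeightOneSpectrum (NumberField.RingOfIntegers K₀) in cofinite, ρ₀.IsUnramifiedAt v) ∧ ∀ (v : IsDedekindDomain.HeightOneSpectrum (NumberField.RingOfIntegers K₀)) (hv : ((ℓ : ℕ) : NumberField.RingOfIntegers K₀) ∈ v.asIdeal), (Literature.NumberTheory.PAdicHodge.fontainePstAdicCompletion v ℓ hv).IsDeRhamFramed (ρ₀.toLocal v)) ∧ ((∀ᶠ v : IsDedekindDomain.HeightOneSpectrum (NumberField.RingOfIntegers K) in cofinite, χ.IsUnramifiedAt v) ∧ ∀ (v : IsDedekindDomain.HeightOneSpectrum (NumberField.RingOfIntegers K)) (hv : ((ℓ : ℕ) : NumberField.RingOfIntegers K) ∈ v.asIdeal), (Literature.NumberTheory.PAdicHodge.fontainePstAdicCompletion v ℓ hv).IsDeRhamFramed (χ.toLocal v)) ∧ Summit.Langlands.Langlands.Theorems.CoreAdequacy.CycIrr ρ₀ ∧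 (Summit.Langlands.Langlands.Theorems.CoreAdequacy.AdequateCyclotomicImage ρ₀ ∨ Summit.Langlands.Langlands.Theorems.CoreAdequacy.SolvablyAdequateImage ρ₀) ∧ ∀ g : Field.absoluteGaloisGroup K, Literature.NumberTheory.GaloisRepresentations.FramedRep.trace ρ g = Literature.NumberTheory.GaloisRepresentations.FramedRep.trace χ g * Literature.NumberTheory.GaloisRepresentations.FramedRep.trace (ρ₀.restrictField K) g) → (∃ τ : Field.absoluteGaloisGroup (CyclotomicField ℓ K) →* Matrix.GeneralLinearGroup (Fin n) (Literature.NumberTheory.GaloisRepresentations.padicAlgClResidueField ℓ), (ρ.restrictField (CyclotomicField ℓ K)).IsReductionOf (RingHom.id (Literature.NumberTheory.GaloisRepresentations.padicAlgClResidueField ℓ)) τ ∧ Literature.NumberTheory.GaloisRepresentations.IsAbsIrreducible τ ∧ ∃ J : Subgroup (Matrix.GeneralLinearGroup (Fin n) (Literature.NumberTheory.GaloisRepresentations.padicAlgClResidueField ℓ)), (∀ Q : Subgroup (Matrix.GeneralLinearGroup (Fin n) (Literature.NumberTheory.GaloisRepresentations.padicAlgClResidueField ℓ)), Q ≤ τ.range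 → ⁅Q, Q⁆ = Q → Q ≤ J) ∧ J ≤ τ.range ∧ Literature.NumberTheory.GaloisRepresentations.IsAbsIrreducible J.subtype ∧ (∀ f : Additive J →+ Literature.NumberTheory.GaloisRepresentations.padicAlgClResidueField ℓ, f = 0) ∧ (Literature.NumberTheory.GaloisRepresentations.Subgroup.adZeroRep J).invariants = ⊥ ∧ ∀ W : Subrepresentation (Literature.NumberTheory.GaloisRepresentations.Subgroup.adZeroRep J), IsAtom W → ∃ h : J, (orderOf h.1).Coprime (ringChar (Literature.NumberTheory.GaloisRepresentations.padicAlgClResidueField ℓ)) ∧ ∃ α : Literature.NumberTheory.GaloisRepresentations.padicAlgClResidueField ℓ, ∃ w ∈ W, (Literature.NumberTheory.GaloisRepresentations.eigenprojectionMatrix (h.1 : Matrix (Fin n) (Fin n) (Literature.NumberTheory.GaloisRepresentations.padicAlgClResidueField ℓ)) α * w.1).trace ≠ 0) → ¬ Summit.Langlands.Langlands.Theorems.BrightMate.SolvablyReducible ρ → ¬ Summit.Langlands.Langlands.Theorems.BrightMate.SolvablyMated ι ρ → Summit.Langlands.Langlands.Theorems.CoreAdequacy.LiftTail K n hcpt ℓ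 ι ρ) →
    (∀ (K : Type) [Field K] [NumberField K] (n : ℕ) (hcpt : Literature.NumberTheory.Automorphic.isCompact_glFiniteIntegralLevel n K), 0 < n → Summit.Langlands.Langlands.Theorems.CoreAdequacy.LiftBelow n → ∀ (ℓ : ℕ) [Fact ℓ.Prime] (ι : PadicAlgCl ℓ ≃+* ℂ) (ρ : Literature.NumberTheory.GaloisRepresentations.FramedGaloisRep K (PadicAlgCl ℓ) n), ℓ < 2 * (n + 1) → ¬ NumberField.IsTotallyReal K → n ≤ 2 → Summit.Langlands.Langlands.Theorems.CoreAdequacy.CycIrr ρ → ¬ Summit.Langlands.Langlands.Theorems.CoreAdequacy.AdequateCyclotomicImage ρ → ¬ Summit.Langlands.Langlands.Theorems.CoreAdequacy.SolvablyAdequateImage ρ → ¬ (∃ (K₀ : Type) (_ : Field K₀) (_ : NumberField K₀) (_ : Algebra K₀ K), IsGalois K₀ K ∧ IsSolvable (K ≃ₐ[K₀] K) ∧ ∃ (ρ₀ : Literature.NumberTheory.GaloisRepresentations.FramedGaloisRep K₀ (PadicAlgCl ℓ) n) (χ : Literature.NumberTheory.GaloisRepresentations.FramedGaloisRep K (PadicAlgCl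 ℓ) 1), ρ₀.toGaloisRep.IsIrreducible ∧ ((∀ᶠ v : IsDedekindDomain.HeightOneSpectrum (NumberField.RingOfIntegers K₀) in cofinite, ρ₀.IsUnramifiedAt v) ∧ ∀ (v : IsDedekindDomain.HeightOneSpectrum (NumberField.RingOfIntegers K₀)) (hv : ((ℓ : ℕ) : NumberField.RingOfIntegers K₀) ∈ v.asIdeal), (Literature.NumberTheory.PAdicHodge.fontainePstAdicCompletion v ℓ hv).IsDeRhamFramed (ρ₀.toLocal v)) ∧ ((∀ᶠ v : IsDedekindDomain.HeightOneSpectrum (NumberField.RingOfIntegers K) in cofinite, χ.IsUnramifiedAt v) ∧ ∀ (v : IsDedekindDomain.HeightOneSpectrum (NumberField.RingOfIntegers K)) (hv : ((ℓ : ℕ) : NumberField.RingOfIntegers K) ∈ v.asIdeal), (Literature.NumberTheory.PAdicHodge.fontainePstAdicCompletion v ℓ hv).IsDeRhamFramed (χ.toLocal v)) ∧ Summit.Langlands.Langlands.Theorems.CoreAdequacy.CycIrr ρ₀ ∧ (Summit.Langlands.Langlands.Theorems.CoreAdequacy.AdequateCyclotomicImage ρ₀ ∨ Summit.Langlands.Langlands.Theorems.CoreAdequacy.SolvablyAdequateImage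 ρ₀) ∧ ∀ g : Field.absoluteGaloisGroup K, Literature.NumberTheory.GaloisRepresentations.FramedRep.trace ρ g = Literature.NumberTheory.GaloisRepresentations.FramedRep.trace χ g * Literature.NumberTheory.GaloisRepresentations.FramedRep.trace (ρ₀.restrictField K) g) → (∃ τ : Field.absoluteGaloisGroup (CyclotomicField ℓ K) →* Matrix.GeneralLinearGroup (Fin n) (Literature.NumberTheory.GaloisRepresentations.padicAlgClResidueField ℓ), (ρ.restrictField (CyclotomicField ℓ K)).IsReductionOf (RingHom.id (Literature.NumberTheory.GaloisRepresentations.padicAlgClResidueField ℓ)) τ ∧ Literature.NumberTheory.GaloisRepresentations.IsAbsIrreducible τ ∧ ∃ J : Subgroup (Matrix.GeneralLinearGroup (Fin n) (Literature.NumberTheory.GaloisRepresentations.padicAlgClResidueField ℓ)), (∀ Q : Subgroup (Matrix.GeneralLinearGroup (Fin n) (Literature.NumberTheory.GaloisRepresentations.padicAlgClResidueField ℓ)), Q ≤ τ.range → ⁅Q, Q⁆ = Q → Q ≤ J) ∧ J ≤ τ.range ∧ Literature.NumberTheory.GaloisRepresentations.IsAbsIrreducible J.subtype ∧ (∀ f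 : Additive J →+ Literature.NumberTheory.GaloisRepresentations.padicAlgClResidueField ℓ, f = 0) ∧ (Literature.NumberTheory.GaloisRepresentations.Subgroup.adZeroRep J).invariants = ⊥ ∧ ∀ W : Subrepresentation (Literature.NumberTheory.GaloisRepresentations.Subgroup.adZeroRep J), IsAtom W → ∃ h : J, (orderOf h.1).Coprime (ringChar (Literature.NumberTheory.GaloisRepresentations.padicAlgClResidueField ℓ)) ∧ ∃ α : Literature.NumberTheory.GaloisRepresentations.padicAlgClResidueField ℓ, ∃ w ∈ W, (Literature.NumberTheory.GaloisRepresentations.eigenprojectionMatrix (h.1 : Matrix (Fin n) (Fin n) (Literature.NumberTheory.GaloisRepresentations.padicAlgClResidueField ℓ)) α * w.1).trace ≠ 0) → ¬ Summit.Langlands.Langlands.Theorems.BrightMate.SolvablyReducible ρ → ¬ Summit.Langlands.Langlands.Theorems.BrightMate.SolvablyMated ι ρ → Summit.Langlands.Langlands.Theorems.CoreAdequacy.LiftTail K n hcpt ℓ ι ρ) →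
    (∀ (K : Type) [Field K] [NumberField K] (n : ℕ) (hcpt : Literature.NumberTheory.Automorphic.isCompact_glFiniteIntegralLevel n K), 0 < n → Summit.Langlands.Langlands.Theorems.CoreAdequacy.LiftBelow n → ∀ (ℓ : ℕ) [Fact ℓ.Prime] (ι : PadicAlgCl ℓ ≃+* ℂ) (ρ : Literature.NumberTheory.GaloisRepresentations.FramedGaloisRep K (PadicAlgCl ℓ) n), ℓ < 2 * (n + 1) → 3 ≤ n → Summit.Langlands.Langlands.Theorems.CoreAdequacy.CycIrr ρ → ¬ Summit.Langlands.Langlands.Theorems.CoreAdequacy.AdequateCyclotomicImage ρ → ¬ Summit.Langlands.Langlands.Theorems.CoreAdequacy.SolvablyAdequateImage ρ → ¬ (∃ (K₀ : Type) (_ : Field K₀) (_ : NumberField K₀) (_ : Algebra K₀ K), IsGalois K₀ K ∧ IsSolvable (K ≃ₐ[K₀] K) ∧ ∃ (ρ₀ : Literature.NumberTheory.GaloisRepresentations.FramedGaloisRep K₀ (PadicAlgCl ℓ) n) (χ : Literature.NumberTheory.GaloisRepresentations.FramedGaloisRep K (PadicAlgCl ℓ) 1), ρ₀.toGaloisRep.IsIrreducible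 ∧ ((∀ᶠ v : IsDedekindDomain.HeightOneSpectrum (NumberField.RingOfIntegers K₀) in cofinite, ρ₀.IsUnramifiedAt v) ∧ ∀ (v : IsDedekindDomain.HeightOneSpectrum (NumberField.RingOfIntegers K₀)) (hv : ((ℓ : ℕ) : NumberField.RingOfIntegers K₀) ∈ v.asIdeal), (Literature.NumberTheory.PAdicHodge.fontainePstAdicCompletion v ℓ hv).IsDeRhamFramed (ρ₀.toLocal v)) ∧ ((∀ᶠ v : IsDedekindDomain.HeightOneSpectrum (NumberField.RingOfIntegers K) in cofinite, χ.IsUnramifiedAt v) ∧ ∀ (v : IsDedekindDomain.HeightOneSpectrum (NumberField.RingOfIntegers K)) (hv : ((ℓ : ℕ) : NumberField.RingOfIntegers K) ∈ v.asIdeal), (Literature.NumberTheory.PAdicHodge.fontainePstAdicCompletion v ℓ hv).IsDeRhamFramed (χ.toLocal v)) ∧ Summit.Langlands.Langlands.Theorems.CoreAdequacy.CycIrr ρ₀ ∧ (Summit.Langlands.Langlands.Theorems.CoreAdequacy.AdequateCyclotomicImage ρ₀ ∨ Summit.Langlands.Langlands.Theorems.CoreAdequacy.SolvablyAdequateImage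 ρ₀) ∧ ∀ g : Field.absoluteGaloisGroup K, Literature.NumberTheory.GaloisRepresentations.FramedRep.trace ρ g = Literature.NumberTheory.GaloisRepresentations.FramedRep.trace χ g * Literature.NumberTheory.GaloisRepresentations.FramedRep.trace (ρ₀.restrictField K) g) → (∃ τ : Field.absoluteGaloisGroup (CyclotomicField ℓ K) →* Matrix.GeneralLinearGroup (Fin n) (Literature.NumberTheory.GaloisRepresentations.padicAlgClResidueField ℓ), (ρ.restrictField (CyclotomicField ℓ K)).IsReductionOf (RingHom.id (Literature.NumberTheory.GaloisRepresentations.padicAlgClResidueField ℓ)) τ ∧ Literature.NumberTheory.GaloisRepresentations.IsAbsIrreducible τ ∧ ∃ J : Subgroup (Matrix.GeneralLinearGroup (Fin n) (Literature.NumberTheory.GaloisRepresentations.padicAlgClResidueField ℓ)), (∀ Q : Subgroup (Matrix.GeneralLinearGroup (Fin n) (Literature.NumberTheory.GaloisRepresentations.padicAlgClResidueField ℓ)), Q ≤ τ.range → ⁅Q, Q⁆ = Q → Q ≤ J) ∧ J ≤ τ.range ∧ Literature.NumberTheory.GaloisRepresentations.IsAbsIrreducible J.subtype ∧ (∀ f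 : Additive J →+ Literature.NumberTheory.GaloisRepresentations.padicAlgClResidueField ℓ, f = 0) ∧ (Literature.NumberTheory.GaloisRepresentations.Subgroup.adZeroRep J).invariants = ⊥ ∧ ∀ W : Subrepresentation (Literature.NumberTheory.GaloisRepresentations.Subgroup.adZeroRep J), IsAtom W → ∃ h : J, (orderOf h.1).Coprime (ringChar (Literature.NumberTheory.GaloisRepresentations.padicAlgClResidueField ℓ)) ∧ ∃ α : Literature.NumberTheory.GaloisRepresentations.padicAlgClResidueField ℓ, ∃ w ∈ W, (Literature.NumberTheory.GaloisRepresentations.eigenprojectionMatrix (h.1 : Matrix (Fin n) (Fin n) (Literature.NumberTheory.GaloisRepresentations.padicAlgClResidueField ℓ)) α * w.1).trace ≠ 0) → ¬ Summit.Langlands.Langlands.Theorems.BrightMate.SolvablyReducible ρ → ¬ Summit.Langlands.Langlands.Theorems.BrightMate.SolvablyMated ι ρ → Summit.Langlands.Langlands.Theorems.CoreAdequacy.LiftTail K n hcpt ℓ ι ρ) →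
    LieObstructedLifting := by
  intro hR hN hH K _ _ n hcpt hn ih ℓ _ ι ρ hlt
  by_cases h2 : n ≤ 2
  · by_cases hT : NumberField.IsTotallyReal K
    · exact hR K n hcpt hn ih ℓ ι ρ hlt hT h2
    · exact hN K n hcpt hn ih ℓ ι ρ hlt hT h2
  · exact hH K n hcpt hn ih ℓ ι ρ hlt (by omega)

/-- LIE from its registered stubs (the form `ledger skeleton check` records). -/
theorem LieObstructedLifting_proof : Summit.Langlands.Langlands.Theses.LieDefectSplit.LieObstructedLifting :=
  LieObstructedLifting_of stub_rung_rankLe2_totallyReal stub_lie_rankLe2_nonTotallyReal stub_lie_rankGe3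

end Summit.Langlands.Langlands.Cruxes.LieObstructedLifting.Birth
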